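import Summits.SmoothPoincare4.SmoothPoincare4.Theorems.SymplecticOrigamiGromovRecognitionRelEndNoJSpheres
import Literature.Geometry.Kaehler.ManifoldFormsPullback
import Mathlib.Geometry.Manifold.LocalDiffeomorph

/-!
# No `JX`-spheres of the cap inside `ι(M)`
(registered helper `helper_noJSpheresInImage` of line `cross-cap-laurent`, crux
`GromovRecognitionRelEnd`, item stmt-SmoothPoincare4-11009)

The wedge cap `X` of a connected 4-manifold `M` with `π₂(M) = 0` contains `ι(M)` along an injective
local diffeomorphism `ι : M → X` intertwining the almost complex structures `J` (on `M`) and `JX`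
(on `X`); `ωX` is a closed smooth `2`-form on `X` taming `JX`.  The compactness step of the core
stub consumes: **a `JX`-holomorphic two-chart sphere `(u, v)` of `X` (`v z = u z⁻¹`) lying inside
`range ι` is constant.**

Proof: pull everything back to `M` and apply `helper_noJSpheres`.  With `g := Function.invFun ι`
(a left inverse of `ι`, smooth on the open set `range ι` since near a point `ι x` it is the inverse
of a partial diffeomorphism representing `ι` at `x`), the lifts `ũ := g ∘ u`, `ṽ := g ∘ v` are
smooth, satisfy `ι ∘ ũ = u`, `ṽ z = ũ z⁻¹`, and are `J`-holomorphic: from `u = ι ∘ ũ` and the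
chain rule, `dι (dũ (i ζ)) = JX (dι (dũ ζ)) = dι (J (dũ ζ))`, and `dι` is injective (a local
diffeomorphism).  The pulled-back form `sf := ι^* ωX` is closed and smooth
(`pullback_mem_closedSmoothForms`) and tames `J`:
`sf(w, J w) = ωX(dι w, dι (J w)) = ωX(dι w, JX (dι w)) > 0` for `w ≠ 0`.  Hence
`helper_noJSpheres` gives `ũ z = ũ 0`, and `u z = ι (ũ z) = ι (ũ 0) = u 0`.
-/

-- the prescribed namespace `Summit.<P>.<Sub>.…` duplicates `SmoothPoincare4` (P = Sub)
set_option linter.dupNamespace false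

open scoped Manifold ContDiff Topology
open Set Function
open Literature.Geometry.Kaehler Literature.Geometry.Symplectic Literature.NumberTheory.Transcendental

namespace Summit.SmoothPoincare4.SmoothPoincare4.Theorems.GromovRecognitionRelEnd.CrossCapLaurent

namespace NoJSpheresInImage

/-- The lift of a curve `u` inside `range ι` composed with `ι` is the curve:
`ι ∘ (invFun ι ∘ u) = u`. [folklore] -/
theorem comp_invFun_comp {M X : Type} [Nonempty M] {ι : M → X} {u : ℂ → X}
    (hur : ∀ z, u z ∈ range ι) : ι ∘ (invFun ι ∘ u) = u :=
  funext fun z => invFun_eq (hur z)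

section Lift

variable {M : Type} [TopologicalSpace M] [ChartedSpace (EuclideanSpace ℝ (Fin 4)) M]
  {X : Type} [TopologicalSpace X] [ChartedSpace (EuclideanSpace ℝ (Fin 4)) X] {ι : M → X}

/-- **The inverse of an injective local diffeomorphism is smooth at every point of the range**:
near `ι x` it agrees with the inverse of a partial diffeomorphism representing `ι` at `x`.
[folklore] -/
theorem contMDiffAt_invFun [Nonempty M] (hι : IsLocalDiffeomorph (𝓡 4) (𝓡 4) ∞ ι)
    (hinj : Injective ι) {y : X} (hy : y ∈ range ι) :
    ContMDiffAt (𝓡 4) (𝓡 4) ∞ (invFun ι) y := by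
  obtain ⟨x, rfl⟩ := hy
  obtain ⟨e, hxe, heq⟩ := hι x
  have hxt : ι x ∈ e.target := by
    rw [heq hxe]
    exact e.map_source hxe
  have hes : ContMDiffAt (𝓡 4) (𝓡 4) ∞ e.symm (ι x) :=
    e.contMDiffOn_invFun.contMDiffAt (e.open_target.mem_nhds hxt)
  refine hes.congr_of_eventuallyEq ?_
  filter_upwards [e.open_target.mem_nhds hxt] with y hy
  have hw : e.symm y ∈ e.source := e.map_target hy
  have h1 : ι (e.symm y) = y := (heq hw).trans (e.right_inv hy)
  calc invFun ι y = invFun ι (ι (e.symm y)) := by rw [h1]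
    _ = e.symm y := leftInverse_invFun hinj _

/-- A smooth curve `u : ℂ → X` inside `range ι` lifts to the smooth curve `invFun ι ∘ u` of `M`.
[folklore] -/
theorem contMDiff_invFun_comp [Nonempty M] (hι : IsLocalDiffeomorph (𝓡 4) (𝓡 4) ∞ ι)
    (hinj : Injective ι) {u : ℂ → X} (hu : ContMDiff 𝓘(ℝ, ℂ) (𝓡 4) ∞ u)
    (hur : ∀ z, u z ∈ range ι) : ContMDiff 𝓘(ℝ, ℂ) (𝓡 4) ∞ (invFun ι ∘ u) := fun z =>
  (contMDiffAt_invFun hι hinj (hur z)).comp z (hu z)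

/-- The differential of a local diffeomorphism is injective. [folklore] -/
theorem mfderiv_injective (hι : IsLocalDiffeomorph (𝓡 4) (𝓡 4) ∞ ι) (x : M) :
    Injective (mfderiv (𝓡 4) (𝓡 4) ι x) := by
  have h := ((hι x).mfderivToContinuousLinearEquiv (by simp)).injective
  rwa [← ContinuousLinearEquiv.coe_coe,
    IsLocalDiffeomorphAt.mfderivToContinuousLinearEquiv_coe] at h

variable [IsManifold (𝓡 4) ∞ M] [IsManifold (𝓡 4) ∞ X]

/-- **The lift of a `JX`-holomorphic curve along a `(J, JX)`-holomorphic injective local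
diffeomorphism is `J`-holomorphic**: `dι (dũ (i ζ)) = du (i ζ) = JX (du ζ) = JX (dι (dũ ζ)) =
dι (J (dũ ζ))`, and `dι` is injective. [folklore] -/
theorem isJHolomorphic_invFun_comp [Nonempty M] (J : AlmostComplexStructure (𝓡 4) ∞ M)
    (JX : AlmostComplexStructure (𝓡 4) ∞ X) (hι : IsLocalDiffeomorph (𝓡 4) (𝓡 4) ∞ ι)
    (hinj : Injective ι)
    (hJι : ∀ (x : M) (w : TangentSpace (𝓡 4) x),
      JX (ι x) (mfderiv (𝓡 4) (𝓡 4) ι x w) = mfderiv (𝓡 4) (𝓡 4) ι x (J x w))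
    {u : ℂ → X} (hu : ContMDiff 𝓘(ℝ, ℂ) (𝓡 4) ∞ u) (hur : ∀ z, u z ∈ range ι)
    (hJu : IsJHolomorphic (𝓡 4) (fun y => JX y) u) :
    IsJHolomorphic (𝓡 4) (fun y => J y) (invFun ι ∘ u) := by
  intro z ζ
  set ut : ℂ → M := invFun ι ∘ u with hut
  have hιd : MDifferentiableAt (𝓡 4) (𝓡 4) ι (ut z) := (hι (ut z)).mdifferentiableAt (by simp)
  have hutd : MDifferentiableAt 𝓘(ℝ, ℂ) (𝓡 4) ut z :=
    (contMDiff_invFun_comp hι hinj hu hur z).mdifferentiableAt (by simp)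
  have hfun : ι ∘ ut = u := comp_invFun_comp hur
  have huz : u z = ι (ut z) := (invFun_eq (hur z)).symm
  -- chain rule: `du_z = dι_{ũ z} ∘ dũ_z`
  have hcomp : ∀ ξ : ℂ, mfderiv 𝓘(ℝ, ℂ) (𝓡 4) u z ξ =
      mfderiv (𝓡 4) (𝓡 4) ι (ut z) (mfderiv 𝓘(ℝ, ℂ) (𝓡 4) ut z ξ) := by
    intro ξ
    have hc := mfderiv_comp z hιd hutd
    rw [hfun] at hc
    exact DFunLike.congr_fun hc ξ
  have h := hJu z ζ
  dsimp only at h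
  rw [hcomp, hcomp, huz, hJι (ut z)] at h
  exact mfderiv_injective hι (ut z) h

/-- **The pull-back of a taming form along a `(J, JX)`-holomorphic local diffeomorphism tames
`J`**: `(ι^*ωX)(w, J w) = ωX(dι w, dι (J w)) = ωX(dι w, JX (dι w)) > 0` for `w ≠ 0`, as `dι` is
injective. [folklore] -/
theorem isTamedBy_pullback {J : AlmostComplexStructure (𝓡 4) ∞ M}
    {JX : AlmostComplexStructure (𝓡 4) ∞ X} {ωX : MForm (𝓡 4) X ℝ 2} (ht : JX.IsTamedBy ωX)
    (hι : IsLocalDiffeomorph (𝓡 4) (𝓡 4) ∞ ι)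
    (hJι : ∀ (x : M) (w : TangentSpace (𝓡 4) x),
      JX (ι x) (mfderiv (𝓡 4) (𝓡 4) ι x w) = mfderiv (𝓡 4) (𝓡 4) ι x (J x w)) :
    J.IsTamedBy (ωX.pullback (𝓡 4) ι) := by
  intro x w hw
  rw [MForm.pullback_apply]
  have hvec : (fun i => mfderiv (𝓡 4) (𝓡 4) ι x (![w, J x w] i)) =
      ![mfderiv (𝓡 4) (𝓡 4) ι x w, JX (ι x) (mfderiv (𝓡 4) (𝓡 4) ι x w)] := by
    rw [hJι]
    funext i
    fin_cases i <;> rfl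
  rw [hvec]
  refine ht (ι x) _ fun h0 => hw (mfderiv_injective hι x ?_)
  rw [h0, map_zero]

end Lift

end NoJSpheresInImage

/-- **No `JX`-spheres of the cap inside `ι(M)`** (registered helper `helper_noJSpheresInImage` of
line `cross-cap-laurent`).  Let `M` be a connected smooth 4-manifold with `π₂(M) = 0`, `X` a
smooth 4-manifold, `J`, `JX` almost complex structures on `M`, `X`, `ωX` a closed smooth `2`-form
on `X` taming `JX`, and `ι : M → X` an injective local diffeomorphism with `JX ∘ dι = dι ∘ J`.
Then every `JX`-holomorphic two-chart sphere `(u, v)` of `X` (`u, v : ℂ → X` smooth,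
`v z = u z⁻¹` off `0`) whose two charts take values in `range ι` is constant: `u z = u 0`.
Proof: the lifts `invFun ι ∘ u`, `invFun ι ∘ v` form a `J`-holomorphic two-chart sphere of `M`,
`J` is tamed by the closed smooth form `ι^* ωX`, and `helper_noJSpheres` applies. -/
theorem helper_noJSpheresInImage : ∀ (M : Type) [TopologicalSpace M] [T2Space M] [SecondCountableTopology M] [ChartedSpace (EuclideanSpace ℝ (Fin 4)) M] [IsManifold (𝓡 4) ∞ M] [ConnectedSpace M] (X : Type) [TopologicalSpace X] [T2Space X] [SecondCountableTopology X] [ChartedSpace (EuclideanSpace ℝ (Fin 4)) X] [IsManifold (𝓡 4) ∞ X] (J : Literature.Geometry.Symplectic.AlmostComplexStructure (𝓡 4) ∞ M) (JX : Literature.Geometry.Symplectic.AlmostComplexStructure (𝓡 4) ∞ X) (ωX : Literature.Geometry.Kaehler.MForm (𝓡 4) X ℝ 2) (ι : M → X) (u v : ℂ → X), (∀ x : M, Subsingleton (π_ 2 M x)) → Literature.Geometry.Kaehler.IsSmoothForm ωX → Literature.Geometry.Kaehler.IsClosedForm ωX → JX.IsTamedBy ωX → IsLocalDiffeomorph (𝓡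 4) (𝓡 4) ∞ ι → Function.Injective ι → (∀ (x : M) (w : TangentSpace (𝓡 4) x), JX (ι x) (mfderiv (𝓡 4) (𝓡 4) ι x w) = mfderiv (𝓡 4) (𝓡 4) ι x (J x w)) → ContMDiff 𝓘(ℝ, ℂ) (𝓡 4) ∞ u → ContMDiff 𝓘(ℝ, ℂ) (𝓡 4) ∞ v → (∀ z : ℂ, z ≠ 0 → v z = u z⁻¹) → Literature.Geometry.Symplectic.IsJHolomorphic (𝓡 4) (fun y => JX y) u → Literature.Geometry.Symplectic.IsJHolomorphic (𝓡 4) (fun y => JX y) v → (∀ z : ℂ, u z ∈ Set.range ι) → (∀ z : ℂ, v z ∈ Set.range ι) → ∀ z : ℂ, u z = u 0 := by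
  intro M _ _ _ _ _ _ X _ _ _ _ _ J JX ωX ι u v hπ hs hc ht hι hinj hJι hu hv huv hJu hJv hur hvr z
  -- the pulled-back form `ι^* ωX` is closed and smooth
  have hsf : ωX.pullback (𝓡 4) ι ∈ closedSmoothForms (𝓡 4) M ℝ 2 :=
    pullback_mem_closedSmoothForms hι.contMDiff ⟨hs, hc⟩
  -- the lifted two-chart sphere of `M` is constant
  have key := helper_noJSpheres M (ωX.pullback (𝓡 4) ι) J (invFun ι ∘ u) (invFun ι ∘ v) hπ
    hsf.1 hsf.2 (NoJSpheresInImage.isTamedBy_pullback ht hι hJι)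
    (NoJSpheresInImage.contMDiff_invFun_comp hι hinj hu hur)
    (NoJSpheresInImage.contMDiff_invFun_comp hι hinj hv hvr)
    (fun w hw => by simp only [Function.comp_apply, huv w hw])
    (NoJSpheresInImage.isJHolomorphic_invFun_comp J JX hι hinj hJι hu hur hJu)
    (NoJSpheresInImage.isJHolomorphic_invFun_comp J JX hι hinj hJι hv hvr hJv) z
  simp only [Function.comp_apply] at key
  calc u z = ι (invFun ι (u z)) := (invFun_eq (hur z)).symm
    _ = ι (invFun ι (u 0)) := by rw [key]
    _ = u 0 := invFun_eq (hur 0)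

end Summit.SmoothPoincare4.SmoothPoincare4.Theorems.GromovRecognitionRelEnd.CrossCapLaurent
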